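import Summits.CriticalPhenomena.PercolationContinuityZ3.Theorems.PercNearOneGluingNoHeavyLowerTailLinearModulus
import HarnessLib

/-!
# The inclusive linear lower tail: sharpened constant `1 + (|A| − 2)/⌈|A|/2⌉` (lane prim-rate, constants-miner 1, row M1-L1)

Support file for the closed crux `NoHeavyLowerTail` (stmt-CriticalPhenomena-4575), continuing
`PercNearOneGluingNoHeavyLowerTailLinearModulus.lean` (audit-3), where the INCLUSIVE linear lower-tail form
`P(1 ≤ N ∧ 2N ≤ |A|) ≤ P(o ↮ A) + C·max_{a∈A} P(a ↮ a₀)` (`a₀ ∈ A` a hub, `N = #{a ∈ A : o ↔ a}`) is proved with `C = 3`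
(`linearLowerTailInclusive_three`) and refuted with `C = 1` (`linearLowerTailInclusive_cex_five`, ratio 20/19).
Here: `C = 1 + (|A| − 2)/⌈|A|/2⌉` (always `< 3`; `= 2` for `|A| ∈ {4, 5}`, `≤ 2` for `|A| ≤ 5`), by charging the hub
block and the non-hub block against the SAME budget `E[Y] = Σ_{a≠a₀} P(a ↮ a₀)`.  The miner's exact family (5-vertex path
`o – s – a₀ – h₁ – h₂`, weights `(1, 1−d, 1−d, 1)`, `A = {s,a₀,h₁,h₂}`: ratio `2 − d`) shows `C ≥ 2` for every `|A| ≥ 4`, so the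
constant is SHARP for `|A| ∈ {4, 5}`; `C = 2` for all `|A|` is conjectured (`run/shared/lean/prim/prim-rate/prim-rate-mine-1/CANDIDATES.md`).
No definitions, no named facts, no sorries. [cite: KozmaNitzan2024, Conj. 1 (p. 3)]
-/

noncomputable section

namespace Summit.CriticalPhenomena.PercolationContinuityZ3.Theorems

open MeasureTheory Set
open Literature.Probability.LatticeModels (prodBernoulli)
open Literature.Probability.Percolation (openConn BondConfig measurableSet_openConn_holds)
open scoped Classical BigOperators

/-! ### Sharpened constant (prim-rate constants-miner 1, row M1-L1): joint bookkeeping of the two blocks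

The constant `3` above charges the hub block by Markov (`2δ₀`) and the non-hub block by additive gluing (`δ₀`)
SEPARATELY.  Charging both against the SAME budget `E[Y] = Σ_{a ≠ a₀} P(a ↮ a₀) ≤ (|A|−1)δ₀`, `Y` = number of relays cut
from the hub — on the hub block `Y ≥ ⌈|A|/2⌉` (an INTEGER at least `|A|/2`), on the non-hub block `{o ↮ a₀, 1 ≤ N}` every relay
seen by `o` is cut from `a₀` so `Y ≥ N ≥ 1`, and on `{o ↮ a₀, 2N > |A|}` likewise `Y ≥ ⌊|A|/2⌋ + 1` — together with additive
gluing `P(o ↮ a₀) ≤ P(o ↮ A) + δ₀` gives the constant `1 + (|A| − 2)/⌈|A|/2⌉` (`= 1, 3/2, 2, 2, 7/3, 9/4, …`, always `< 3`), in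
particular the constant `2` for `|A| ≤ 5`.  Constant `2` is the conjectured sharp value for every `|A| ≥ 4`: the 5-vertex path
`o – s – a₀ – h₁ – h₂` with weights `(1, 1−d, 1−d, 1)`, `A = {s, a₀, h₁, h₂}`, has `P(1 ≤ N ∧ 2N ≤ |A|) = (2 − d)·δ₀` with
`P(o ↮ A) = 0`, `δ₀ = d` (lane prim-rate, `run/shared/lean/prim/prim-rate/prim-rate-mine-1/CANDIDATES.md` §Family L). -/

/-- **Joint block bookkeeping.**  With `Y := #{a ∈ A : a ↮ a₀}`, `E_H := {o ↔ a₀, 2N ≤ |A|}`, `E_B := {o ↮ a₀, 1 ≤ N, 2N ≤ |A|}`,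
`E₃ := {o ↮ a₀, |A| < 2N}`:  `⌈|A|/2⌉·μ(E_H) + μ(E_B) + (⌊|A|/2⌋+1)·μ(E₃) ≤ Σ_{a ∈ A} μ(a ↮ a₀)`.
[cite: KozmaNitzan2024, Conj. 1 (p. 3)] -/
theorem nhltlin_jointBlocks
    (n : ℕ) (w : Sym2 (Fin n) → unitInterval) (A : Finset (Fin n)) (o a₀ : Fin n) :
    (((A.card + 1) / 2 : ℕ) : ℝ) * (prodBernoulli w).real {ω : BondConfig (Fin n) | ω ∈ openConn o a₀ ∧
        2 * (A.filter fun a => ω ∈ openConn o a).card ≤ A.card} +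
      (prodBernoulli w).real {ω : BondConfig (Fin n) | ω ∉ openConn o a₀ ∧
        1 ≤ (A.filter fun a => ω ∈ openConn o a).card ∧ 2 * (A.filter fun a => ω ∈ openConn o a).card ≤ A.card} +
      (((A.card / 2 + 1 : ℕ)) : ℝ) * (prodBernoulli w).real {ω : BondConfig (Fin n) | ω ∉ openConn o a₀ ∧
        A.card < 2 * (A.filter fun a => ω ∈ openConn o a).card}
      ≤ ∑ a ∈ A, (prodBernoulli w).real (openConn a a₀)ᶜ := by
  set μ := prodBernoulli w with hμ
  set k := A.card with hk
  set EH : Set (BondConfig (Fin n)) := {ω | ω ∈ openConn o a₀ ∧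
    2 * (A.filter fun a => ω ∈ openConn o a).card ≤ k} with hEH
  set EB : Set (BondConfig (Fin n)) := {ω | ω ∉ openConn o a₀ ∧
    1 ≤ (A.filter fun a => ω ∈ openConn o a).card ∧ 2 * (A.filter fun a => ω ∈ openConn o a).card ≤ k} with hEB
  set E3 : Set (BondConfig (Fin n)) := {ω | ω ∉ openConn o a₀ ∧
    k < 2 * (A.filter fun a => ω ∈ openConn o a).card} with hE3
  have hms : ∀ S : Set (BondConfig (Fin n)), MeasurableSet S := fun _ => MeasurableSet.of_discrete
  -- `Y` as a sum of indicators
  set Y : BondConfig (Fin n) → ℝ :=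
    fun ω => ∑ a ∈ A, ((openConn a a₀ : Set (BondConfig (Fin n)))ᶜ).indicator (fun _ => (1 : ℝ)) ω with hY
  have hint : ∀ a ∈ A, Integrable
      (((openConn a a₀ : Set (BondConfig (Fin n)))ᶜ).indicator (fun _ => (1 : ℝ))) μ :=
    fun a _ => (integrable_const (1 : ℝ)).indicator (hms _)
  have hY_int : Integrable Y μ := integrable_finsetSum A hint
  have hY_integral : ∫ ω, Y ω ∂μ = ∑ a ∈ A, μ.real (openConn a a₀)ᶜ := by
    rw [integral_finsetSum A hint]
    refine Finset.sum_congr rfl fun a ha => ?_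
    rw [integral_indicator_const (1 : ℝ) (hms _), smul_eq_mul, mul_one]
  -- `Y ω` is the number of relays cut from the hub
  have hYcard : ∀ ω, Y ω = ((A.filter fun a => ω ∉ openConn a a₀).card : ℝ) := by
    intro ω
    have hterm : ∀ a ∈ A, ((openConn a a₀ : Set (BondConfig (Fin n)))ᶜ).indicator (fun _ => (1 : ℝ)) ω
        = if ω ∉ openConn a a₀ then (1 : ℝ) else 0 := by
      intro a _
      by_cases h : ω ∈ openConn a a₀ <;> simp [h]
    simp only [hY]
    rw [Finset.sum_congr rfl hterm, Finset.sum_boole]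
  -- the comparison function `F1 + F2 + F3 ≤ Y`
  set c : ℝ := (((k + 1) / 2 : ℕ) : ℝ) with hc
  set f : ℝ := (((k / 2 + 1 : ℕ)) : ℝ) with hf
  set F1 : BondConfig (Fin n) → ℝ := fun ω => c * EH.indicator (fun _ => (1 : ℝ)) ω with hF1
  set F2 : BondConfig (Fin n) → ℝ := fun ω => EB.indicator (fun _ => (1 : ℝ)) ω with hF2
  set F3 : BondConfig (Fin n) → ℝ := fun ω => f * E3.indicator (fun _ => (1 : ℝ)) ω with hF3
  have hgi : ∀ S : Set (BondConfig (Fin n)), Integrable (S.indicator (fun _ => (1 : ℝ))) μ :=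
    fun S => (integrable_const (1 : ℝ)).indicator (hms S)
  have hF1i : Integrable F1 μ := (hgi EH).const_mul c
  have hF2i : Integrable F2 μ := hgi EB
  have hF3i : Integrable F3 μ := (hgi E3).const_mul f
  have I1 : ∫ ω, F1 ω ∂μ = c * μ.real EH := by
    simp only [hF1]
    rw [integral_const_mul, integral_indicator_const (1 : ℝ) (hms EH), smul_eq_mul, mul_one]
  have I2 : ∫ ω, F2 ω ∂μ = μ.real EB := by
    simp only [hF2]
    rw [integral_indicator_const (1 : ℝ) (hms EB), smul_eq_mul, mul_one]
  have I3 : ∫ ω, F3 ω ∂μ = f * μ.real E3 := by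
    simp only [hF3]
    rw [integral_const_mul, integral_indicator_const (1 : ℝ) (hms E3), smul_eq_mul, mul_one]
  have I12 : ∫ ω, (F1 ω + F2 ω) ∂μ = (∫ ω, F1 ω ∂μ) + ∫ ω, F2 ω ∂μ := integral_add hF1i hF2i
  have hF12i : Integrable (fun ω => F1 ω + F2 ω) μ := hF1i.add hF2i
  have I123 : ∫ ω, ((F1 ω + F2 ω) + F3 ω) ∂μ = (∫ ω, (F1 ω + F2 ω) ∂μ) + ∫ ω, F3 ω ∂μ :=
    integral_add hF12i hF3i
  -- pointwise `F1 + F2 + F3 ≤ Y`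
  have hgY : ∀ ω, (F1 ω + F2 ω) + F3 ω ≤ Y ω := by
    intro ω
    rw [hYcard ω]
    simp only [hF1, hF2, hF3]
    -- relays seen by `o` but not by `a₀`: if `o ↮ a₀` then every relay seen by `o` is cut from `a₀`
    have hsub : ω ∉ openConn o a₀ →
        (A.filter fun a => ω ∈ openConn o a).card ≤ (A.filter fun a => ω ∉ openConn a a₀).card := by
      intro hoa
      refine Finset.card_le_card fun a ha => ?_
      rw [Finset.mem_filter] at ha ⊢
      refine ⟨ha.1, fun h => hoa ?_⟩
      simp only [openConn, Set.mem_setOf_eq] at ha h ⊢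
      exact ha.2.trans h
    -- if `o ↔ a₀` then the relays seen by `o` are exactly those seen by `a₀`
    have heq : ω ∈ openConn o a₀ →
        (A.filter fun a => ω ∈ openConn o a).card + (A.filter fun a => ω ∉ openConn a a₀).card = k := by
      intro hoa
      have hfilt : (A.filter fun a => ω ∈ openConn o a) = (A.filter fun a => ω ∈ openConn a a₀) := by
        refine Finset.filter_congr fun a _ => ?_
        simp only [openConn, Set.mem_setOf_eq] at hoa ⊢
        exact ⟨fun h => h.symm.trans hoa, fun h => hoa.trans h.symm⟩
      rw [hfilt, hk]
      exact Finset.card_filter_add_card_filter_not _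
    have hYnn : (0 : ℝ) ≤ ((A.filter fun a => ω ∉ openConn a a₀).card : ℝ) := Nat.cast_nonneg _
    have hc0 : 0 ≤ c := by rw [hc]; exact Nat.cast_nonneg _
    have hf0 : 0 ≤ f := by rw [hf]; exact Nat.cast_nonneg _
    by_cases hoa : ω ∈ openConn o a₀
    · have hnB : ω ∉ EB := fun h => h.1 hoa
      have hn3 : ω ∉ E3 := fun h => h.1 hoa
      rw [Set.indicator_of_notMem hnB, Set.indicator_of_notMem hn3]
      by_cases hN : 2 * (A.filter fun a => ω ∈ openConn o a).card ≤ k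
      · have hH : ω ∈ EH := ⟨hoa, hN⟩
        rw [Set.indicator_of_mem hH]
        have h1 := heq hoa
        have hnat : (k + 1) / 2 ≤ (A.filter fun a => ω ∉ openConn a a₀).card := by omega
        have hcast : c ≤ ((A.filter fun a => ω ∉ openConn a a₀).card : ℝ) := by
          rw [hc]; exact_mod_cast hnat
        linarith
      · have hnH : ω ∉ EH := fun h => hN h.2
        rw [Set.indicator_of_notMem hnH]
        linarith
    · have hnH : ω ∉ EH := fun h => hoa h.1
      rw [Set.indicator_of_notMem hnH]
      have h1 := hsub hoa
      by_cases hN1 : 1 ≤ (A.filter fun a => ω ∈ openConn o a).card ∧ 2 * (A.filter fun a => ω ∈ openConn o a).card ≤ k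
      · have hB : ω ∈ EB := ⟨hoa, hN1.1, hN1.2⟩
        have hn3 : ω ∉ E3 := fun h => by have := h.2; have := hN1.2; omega
        rw [Set.indicator_of_mem hB, Set.indicator_of_notMem hn3]
        have hcast : (1 : ℝ) ≤ ((A.filter fun a => ω ∉ openConn a a₀).card : ℝ) := by
          have : 1 ≤ (A.filter fun a => ω ∉ openConn a a₀).card := le_trans hN1.1 h1
          exact_mod_cast this
        linarith
      · have hnB : ω ∉ EB := fun h => hN1 ⟨h.2.1, h.2.2⟩
        rw [Set.indicator_of_notMem hnB]
        by_cases hN3 : k < 2 * (A.filter fun a => ω ∈ openConn o a).card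
        · have h3 : ω ∈ E3 := ⟨hoa, hN3⟩
          rw [Set.indicator_of_mem h3]
          have hnat : k / 2 + 1 ≤ (A.filter fun a => ω ∉ openConn a a₀).card := by omega
          have hcast : f ≤ ((A.filter fun a => ω ∉ openConn a a₀).card : ℝ) := by
            rw [hf]; exact_mod_cast hnat
          linarith
        · have hn3 : ω ∉ E3 := fun h => hN3 h.2
          rw [Set.indicator_of_notMem hn3]
          linarith
  have hmono : ∫ ω, ((F1 ω + F2 ω) + F3 ω) ∂μ ≤ ∫ ω, Y ω ∂μ :=
    integral_mono (hF12i.add hF3i) hY_int (fun ω => hgY ω)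
  rw [I123, I12, I1, I2, I3, hY_integral] at hmono
  simpa [hc, hf] using hmono

/-- **The inclusive linear lower tail with the sharpened constant `1 + (|A| − 2)/⌈|A|/2⌉` (`< 3`), from `AdditiveGluing`.**
For a hub `a₀ ∈ A` with `P(a ↮ a₀) ≤ δ₀` on `A`:
`P(1 ≤ N ∧ 2N ≤ |A|) ≤ P(o ↮ A) + (1 + (|A| − 2)/⌈|A|/2⌉)·δ₀`.  [cite: KozmaNitzan2024, Conj. 1 (p. 3)] -/
theorem linearLowerTailInclusive_sharp_of_additiveGluing
    (hA : Summit.CriticalPhenomena.PercolationContinuityZ3.Theses.PercNearOneGluing.AdditiveGluing)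
    (n : ℕ) (w : Sym2 (Fin n) → unitInterval) (A : Finset (Fin n)) (o a₀ : Fin n) (δ₀ : ℝ)
    (ha₀ : a₀ ∈ A) (hδ₀ : ∀ a ∈ A, (prodBernoulli w).real (openConn a a₀)ᶜ ≤ δ₀) :
    (prodBernoulli w).real {ω : BondConfig (Fin n) | 1 ≤ (A.filter fun a => ω ∈ openConn o a).card ∧
        2 * (A.filter fun a => ω ∈ openConn o a).card ≤ A.card}
      ≤ (prodBernoulli w).real (⋃ a ∈ A, openConn o a)ᶜ +
        (1 + ((A.card : ℝ) - 2) / (((A.card + 1) / 2 : ℕ) : ℝ)) * δ₀ := by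
  set μ := prodBernoulli w with hμ
  set k := A.card with hk
  have hδ₀0 : 0 ≤ δ₀ := le_trans measureReal_nonneg (hδ₀ a₀ ha₀)
  have hkpos : 1 ≤ k := Finset.card_pos.mpr ⟨a₀, ha₀⟩
  have hms : ∀ S : Set (BondConfig (Fin n)), MeasurableSet S := fun _ => MeasurableSet.of_discrete
  -- the three events
  set EH : Set (BondConfig (Fin n)) := {ω | ω ∈ openConn o a₀ ∧
    2 * (A.filter fun a => ω ∈ openConn o a).card ≤ k} with hEH
  set EB : Set (BondConfig (Fin n)) := {ω | ω ∉ openConn o a₀ ∧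
    1 ≤ (A.filter fun a => ω ∈ openConn o a).card ∧ 2 * (A.filter fun a => ω ∈ openConn o a).card ≤ k} with hEB
  set E3 : Set (BondConfig (Fin n)) := {ω | ω ∉ openConn o a₀ ∧
    k < 2 * (A.filter fun a => ω ∈ openConn o a).card} with hE3
  set E0 : Set (BondConfig (Fin n)) := (⋃ a ∈ A, openConn o a)ᶜ with hE0
  -- (1) joint bookkeeping: `c·μ(EH) + μ(EB) + f·μ(E3) ≤ Σ_a μ(a ↮ a₀) ≤ (k−1)·δ₀`
  have hjoint := nhltlin_jointBlocks n w A o a₀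
  have hsum : (∑ a ∈ A, μ.real (openConn a a₀)ᶜ) ≤ ((k : ℝ) - 1) * δ₀ := by
    have h0 : μ.real (openConn a₀ a₀ : Set (BondConfig (Fin n)))ᶜ = 0 := by
      have : (openConn a₀ a₀ : Set (BondConfig (Fin n)))ᶜ = ∅ := by
        ext ω
        simp only [Set.mem_compl_iff, openConn, Set.mem_setOf_eq, Set.mem_empty_iff_false, iff_false, not_not]
        exact SimpleGraph.Reachable.refl _
      rw [this, measureReal_empty]
    rw [← Finset.add_sum_erase A _ ha₀, h0, zero_add]
    calc (∑ a ∈ A.erase a₀, μ.real (openConn a a₀)ᶜ) ≤ ∑ _a ∈ A.erase a₀, δ₀ :=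
          Finset.sum_le_sum fun a ha => hδ₀ a (Finset.mem_of_mem_erase ha)
      _ = ((k : ℝ) - 1) * δ₀ := by
        rw [Finset.sum_const, Finset.card_erase_of_mem ha₀, nsmul_eq_mul]
        have : ((k - 1 : ℕ) : ℝ) = (k : ℝ) - 1 := by
          rw [Nat.cast_sub hkpos]; simp
        rw [this]
  -- (2) additive gluing at `b := a₀`: `μ(o ↮ a₀) ≤ μ(E0) + δ₀`, and `{o ↮ a₀} ⊇ E0 ⊔ EB ⊔ E3`
  have hrel : ∀ a ∈ A, 1 - δ₀ ≤ μ.real (openConn a a₀) := by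
    intro a ha
    have h := hδ₀ a ha
    rw [probReal_compl_eq_one_sub (hms _)] at h
    linarith
  have hglue := hA n w A o a₀ δ₀ hδ₀0 hrel
  have hAG : μ.real (openConn o a₀ : Set (BondConfig (Fin n)))ᶜ ≤ μ.real E0 + δ₀ := by
    rw [probReal_compl_eq_one_sub (hms _), hE0, probReal_compl_eq_one_sub (hms _)]
    rw [← hμ] at hglue
    linarith
  have hE0sub : E0 ⊆ (openConn o a₀ : Set (BondConfig (Fin n)))ᶜ := by
    intro ω hω hoa
    rw [hE0, Set.mem_compl_iff] at hω
    exact hω (Set.mem_biUnion (Finset.mem_coe.2 ha₀) hoa)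
  have hE0card : ∀ ω, ω ∈ E0 ↔ (A.filter fun a => ω ∈ openConn o a).card = 0 := by
    intro ω
    rw [hE0, Set.mem_compl_iff, Finset.card_eq_zero, Finset.filter_eq_empty_iff]
    simp only [Set.mem_iUnion, not_exists]
  have hdisj1 : Disjoint E0 (EB ∪ E3) := by
    rw [Set.disjoint_left]
    intro ω h0 h
    have hc := (hE0card ω).1 h0
    rcases h with h | h
    · have := h.2.1; omega
    · have := h.2; omega
  have hdisj2 : Disjoint EB E3 := by
    rw [Set.disjoint_left]
    rintro ω ⟨_, _, h2⟩ ⟨_, h3⟩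
    omega
  have hcover : E0 ∪ (EB ∪ E3) ⊆ (openConn o a₀ : Set (BondConfig (Fin n)))ᶜ := by
    rintro ω (h | h | h)
    · exact hE0sub h
    · exact h.1
    · exact h.1
  have hparts : μ.real E0 + (μ.real EB + μ.real E3) ≤ μ.real (openConn o a₀ : Set (BondConfig (Fin n)))ᶜ := by
    rw [← measureReal_union hdisj2 (hms _), ← measureReal_union hdisj1 ((hms _).union (hms _))]
    exact measureReal_mono hcover
  have hB3 : μ.real EB + μ.real E3 ≤ δ₀ := by linarith
  -- (3) the target event is `EH' ∪ EB` with `EH' ⊆ EH`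
  have hsplit : {ω : BondConfig (Fin n) | 1 ≤ (A.filter fun a => ω ∈ openConn o a).card ∧
      2 * (A.filter fun a => ω ∈ openConn o a).card ≤ k} ⊆ EH ∪ EB := by
    intro ω hω
    by_cases hoa : ω ∈ openConn o a₀
    · exact Or.inl ⟨hoa, hω.2⟩
    · exact Or.inr ⟨hoa, hω.1, hω.2⟩
  have hLHS : μ.real {ω : BondConfig (Fin n) | 1 ≤ (A.filter fun a => ω ∈ openConn o a).card ∧
      2 * (A.filter fun a => ω ∈ openConn o a).card ≤ k} ≤ μ.real EH + μ.real EB :=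
    (measureReal_mono hsplit).trans (measureReal_union_le _ _)
  -- (4) arithmetic: with `c = ⌈k/2⌉ ≥ 1`, `f = ⌊k/2⌋+1 ≥ 1`:
  --     `c·H + B + f·P3 ≤ (k−1)δ₀`, `B + P3 ≤ δ₀`  ⟹  `H + B ≤ ((k−1)/c + 1 − 1/c)·δ₀ = (1 + (k−2)/c)·δ₀`
  set c : ℝ := (((k + 1) / 2 : ℕ) : ℝ) with hc
  set f : ℝ := (((k / 2 + 1 : ℕ)) : ℝ) with hf
  have hc1 : 1 ≤ c := by
    have : 1 ≤ (k + 1) / 2 := by omega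
    rw [hc]; exact_mod_cast this
  have hf1 : 1 ≤ f := by
    have : 1 ≤ k / 2 + 1 := by omega
    rw [hf]; exact_mod_cast this
  have hcpos : 0 < c := by linarith
  have hH0 : 0 ≤ μ.real EH := measureReal_nonneg
  have hB0 : 0 ≤ μ.real EB := measureReal_nonneg
  have hP30 : 0 ≤ μ.real E3 := measureReal_nonneg
  have hE00 : 0 ≤ μ.real E0 := measureReal_nonneg
  rw [← hμ] at hjoint
  have hj : c * μ.real EH + μ.real EB + f * μ.real E3 ≤ ((k : ℝ) - 1) * δ₀ := hjoint.trans hsum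
  -- `c·(H + B) ≤ c·H + B + (c−1)·B ≤ (k−1)δ₀ − f·P3 + (c−1)(δ₀ − P3) ≤ (k − 2 + c)·δ₀`
  have hkey : c * (μ.real EH + μ.real EB) ≤ ((k : ℝ) - 2 + c) * δ₀ := by
    nlinarith [hj, hB3, hc1, hf1, hP30, hB0, hδ₀0]
  have hfinal : μ.real EH + μ.real EB ≤ (1 + ((k : ℝ) - 2) / c) * δ₀ := by
    rw [show (1 + ((k : ℝ) - 2) / c) * δ₀ = (((k : ℝ) - 2 + c) * δ₀) / c by field_simp; ring]
    rw [le_div_iff₀ hcpos]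
    linarith [hkey]
  linarith [hLHS, hfinal, hE00]

/-- **Constant `2` for `|A| ≤ 5`** (`1 + (|A|−2)/⌈|A|/2⌉ ≤ 2` iff `|A| ≤ 5`): for a hub `a₀ ∈ A`, `|A| ≤ 5`,
`P(1 ≤ N ∧ 2N ≤ |A|) ≤ P(o ↮ A) + 2·max_{a∈A} P(a ↮ a₀)` — unconditionally (`CSH.additiveGluing_holds`).  The constant `2` is
conjecturally sharp for every `|A| ≥ 4` (exact family with ratio `2 − d`, prim-rate row M1-L1). [cite: KozmaNitzan2024, Conj. 1 (p. 3)] -/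
theorem linearLowerTailInclusive_two_of_card_le_five
    (n : ℕ) (w : Sym2 (Fin n) → unitInterval) (A : Finset (Fin n)) (o a₀ : Fin n) (δ₀ : ℝ)
    (ha₀ : a₀ ∈ A) (hA5 : A.card ≤ 5) (hδ₀ : ∀ a ∈ A, (prodBernoulli w).real (openConn a a₀)ᶜ ≤ δ₀) :
    (prodBernoulli w).real {ω : BondConfig (Fin n) | 1 ≤ (A.filter fun a => ω ∈ openConn o a).card ∧
        2 * (A.filter fun a => ω ∈ openConn o a).card ≤ A.card}
      ≤ (prodBernoulli w).real (⋃ a ∈ A, openConn o a)ᶜ + 2 * δ₀ := by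
  have h := linearLowerTailInclusive_sharp_of_additiveGluing CSH.additiveGluing_holds n w A o a₀ δ₀ ha₀ hδ₀
  have hδ₀0 : 0 ≤ δ₀ := le_trans measureReal_nonneg (hδ₀ a₀ ha₀)
  have hkpos : 1 ≤ A.card := Finset.card_pos.mpr ⟨a₀, ha₀⟩
  -- `1 + (k−2)/⌈k/2⌉ ≤ 2` for `1 ≤ k ≤ 5`
  have hconst : (1 + ((A.card : ℝ) - 2) / (((A.card + 1) / 2 : ℕ) : ℝ)) ≤ 2 := by
    have hcpos : (0 : ℝ) < (((A.card + 1) / 2 : ℕ) : ℝ) := by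
      have : 1 ≤ (A.card + 1) / 2 := by omega
      exact_mod_cast this
    rw [← sub_nonneg]
    have key : ((A.card : ℝ) - 2) ≤ (((A.card + 1) / 2 : ℕ) : ℝ) := by
      interval_cases hk : A.card <;> norm_num
    have : ((A.card : ℝ) - 2) / (((A.card + 1) / 2 : ℕ) : ℝ) ≤ 1 := by
      rw [div_le_one hcpos]; exact key
    linarith
  calc _ ≤ (prodBernoulli w).real (⋃ a ∈ A, openConn o a)ᶜ +
        (1 + ((A.card : ℝ) - 2) / (((A.card + 1) / 2 : ℕ) : ℝ)) * δ₀ := h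
    _ ≤ (prodBernoulli w).real (⋃ a ∈ A, openConn o a)ᶜ + 2 * δ₀ := by
        have := mul_le_mul_of_nonneg_right hconst hδ₀0
        linarith

end Summit.CriticalPhenomena.PercolationContinuityZ3.Theorems

end
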